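import Summits.QuantumAdvantage.QuantumAdvantage.Theorems.CharDialSubCharJunta
import HarnessLib

/-!
# SymmetricFrob — the Frobenius structure law on the SYMMETRIC class (all `n`, all `p`)

(decomp-qadv-lens-6 g8; evidence (d) of the CharDial node's `FrobStructureLaw`, made kernel.)

`SubChar.symmetric_frob`: a SYMMETRIC Boolean function `f : {0,1}ⁿ → {0,1}` of `𝔽_p`-degree `≤ p − 1` is a
function of the Hamming weight MOD `p`: `f u = H (Σ_i u_i mod p)` — i.e. the law's shape `h(u|_J, Σ aᵢuᵢ)` with
`J = ∅`, `a ≡ 1`.  Proof: the weight profile `Φ` is `p`-periodic (`block_periodic` applied above every vertex with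
`p` spare zeros), hence `Φ w = Φ (w mod p)`.
-/

namespace Summit.QuantumAdvantage.AdviceFreeQNC0

namespace SubChar

open Finset

variable {n : ℕ}

/-- Hamming weight. -/
def hw (u : Fin n → Bool) : ℕ := (univ.filter fun i => u i = true).card

/-- CharDial sub-characteristic helper `hw_le` (lens-6 g8 LAND package; see the module docstring). -/
theorem hw_le (u : Fin n → Bool) : hw u ≤ n := by
  unfold hw; exact (card_filter_le _ _).trans (by simp)

/-- CharDial sub-characteristic helper `hw_setOn` (lens-6 g8 LAND package; see the module docstring). -/
theorem hw_setOn {T : Finset (Fin n)} {u : Fin n → Bool} (hT : ∀ i ∈ T, u i = false) :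
    hw (setOn T u) = hw u + T.card := by
  classical
  unfold hw
  have hset : (univ.filter fun i => setOn T u i = true) = (univ.filter fun i => u i = true) ∪ T := by
    ext i
    simp only [mem_filter, mem_univ, true_and, mem_union, setOn]
    by_cases hi : i ∈ T
    · simp [hi]
    · simp [hi]
  rw [hset, card_union_of_disjoint]
  rw [Finset.disjoint_left]
  intro i hi hiT
  simp only [mem_filter, mem_univ, true_and] at hi
  rw [hT i hiT] at hi
  exact Bool.false_ne_true hi

/-- CharDial sub-characteristic helper `hw_vert` (lens-6 g8 LAND package; see the module docstring). -/
theorem hw_vert (T : Finset (Fin n)) : hw (SubLog.vert T) = T.card := by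
  classical
  unfold hw SubLog.vert
  have h : (univ.filter fun i => decide (i ∈ T) = true) = T := by ext i; simp
  rw [h]

/-- CharDial sub-characteristic helper `natCast_hw` (lens-6 g8 LAND package; see the module docstring). -/
theorem natCast_hw (R : Type*) [AddCommMonoidWithOne R] (u : Fin n → Bool) :
    (hw u : R) = ∑ i, (if u i then (1 : R) else 0) := by
  classical
  unfold hw
  rw [Finset.natCast_card_filter]

/-- **The Frobenius structure law on the symmetric class.**  A symmetric Boolean function of `𝔽_p`-degree
`≤ p − 1` is a function of the Hamming weight mod `p`. -/
theorem symmetric_frob (p : ℕ) [hp : Fact p.Prime] (f : (Fin n → Bool) → Bool)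
    (hsym : ∀ u v : Fin n → Bool, hw u = hw v → f u = f v) (hf : HasDegF p f (p - 1)) :
    ∃ H : ZMod p → Bool, ∀ u, f u = H (∑ i, if u i then (1 : ZMod p) else 0) := by
  classical
  -- the weight profile
  let Φ : ℕ → Bool := fun w => if h : ∃ u : Fin n → Bool, hw u = w then f (Classical.choose h) else false
  have hΦ : ∀ u, f u = Φ (hw u) := by
    intro u
    have h : ∃ v : Fin n → Bool, hw v = hw u := ⟨u, rfl⟩
    simp only [Φ, dif_pos h]
    exact hsym u _ (Classical.choose_spec h).symm
  -- periodicity: Φ (w + p) = Φ w whenever w + p ≤ n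
  have hper : ∀ w, w + p ≤ n → Φ (w + p) = Φ w := by
    intro w hwn
    -- a vertex of weight w
    obtain ⟨T, -, hTcard⟩ := Finset.exists_subset_card_eq (s := (univ : Finset (Fin n))) (n := w) (by simp; omega)
    let u : Fin n → Bool := SubLog.vert T
    have hu : hw u = w := by rw [hw_vert, hTcard]
    -- p spare zeros
    have hZ : p ≤ (univ.filter fun i => u i = false).card := by
      have h1 : (univ.filter fun i => u i = false) = (univ.filter fun i => u i = true)ᶜ := by
        ext i; simp
      rw [h1, Finset.card_compl, Fintype.card_fin]
      have : (univ.filter fun i => u i = true).card = w := hu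
      omega
    obtain ⟨Y, hYsub, hYcard⟩ := Finset.exists_subset_card_eq hZ
    have hY0 : ∀ i ∈ Y, u i = false := by
      intro i hi
      have := hYsub hi
      simpa using this
    have hblock := block_periodic p (d := p - 1) (by have := hp.out.one_lt; omega) hf u Y hYcard hY0
      (fun T₁ hT₁ T₂ hT₂ hc => hsym _ _ (by
        rw [hw_setOn (fun i hi => hY0 i (hT₁ hi)), hw_setOn (fun i hi => hY0 i (hT₂ hi)), hc]))
    have hwY : hw (setOn Y u) = w + p := by rw [hw_setOn hY0, hu, hYcard]
    rw [← hwY, ← hu, ← hΦ, ← hΦ, hblock]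
  -- hence Φ w = Φ (w % p) for w ≤ n
  have hmod : ∀ w, w ≤ n → Φ w = Φ (w % p) := by
    intro w
    induction w using Nat.strong_induction_on with
    | _ w ih =>
      intro hwn
      by_cases hlt : w < p
      · rw [Nat.mod_eq_of_lt hlt]
      · have hpw : p ≤ w := Nat.le_of_not_lt hlt
        have h1 : Φ w = Φ (w - p) := by
          have := hper (w - p) (by omega)
          rwa [Nat.sub_add_cancel hpw] at this
        rw [h1, ih (w - p) (by have := hp.out.pos; omega) (by omega), Nat.mod_eq_sub_mod hpw]
  refine ⟨fun s => Φ s.val, fun u => ?_⟩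
  show f u = Φ (ZMod.val (∑ i, if u i then (1 : ZMod p) else 0))
  rw [← natCast_hw, ZMod.val_natCast, hΦ u]
  exact hmod _ (hw_le u)

end SubChar

end Summit.QuantumAdvantage.AdviceFreeQNC0
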